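import Summits.ValiantsHypothesis.ValiantsHypothesis.Theorems.NewtonUnitEquationsTwoProductsPlanarCellBlockMerge

/-!
# K4 `submerged-band-filtration` — DEFINITIONS of the infrastructure rung «WLOG submerged» (statement texts = val-idea-36 g0)

PROVENANCE: the declarations below are lines 25–82 of `pub/ideators/val-idea-36/Sketch.lean` (sha16 f2f87b116489a0e6; val-idea-36 g0,
crux-ideate lens strengthen-to-induct on stmt-ValiantsHypothesis-5906; card `Cruxes/TwoProducts/Ideas/submerged-band-filtration.md`
@78bded21a88e; critic of record val-idea-crit-8 (WAVE-3 KEEP K4, «infrastructure rung»); director-valiant R289 (1)), filed VERBATIM by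
val-lit-p3 g17 (K4 prover hand, merged-desk RULING #333, 2026-08-28 19:56Z); the only changes are the namespace (`…TwoProducts.Submerged`)
and this header.  Objects: submerged cell families (`IsSubmergedCellFamily`), the one-letter truncation `dropLetter`, and the statements
`BandStep` (L1: exact scale separation at the floor letter), `CellLaw` / `SubmergedCellLaw` (the per-cell law for all / for submerged cell
families), `SubmergedReduction` (L2: `SubmergedCellLaw a b → CellLaw (a+1) (b+1)`), `IsComposite`, `FirstOrderBalance` (L3).  Vocabulary:
`…FormalLogLinearisation` (`Expo`, `wt`, `IsStrictTop`, `ValidWeight`, `tailDiff`, `logSupport`) and `…PlanarCell` (`tuples`, `tailSupport`,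
`IsCellFamily`).  The proofs live in `…SubmergedBandStep` (L1) and the `…SubmergedReduction*` files (L2).
HONEST LABEL: K4 is an exact REDUCTION (indeed an equivalence up to the exponent shift) of the per-cell law to submerged cells —
infrastructure, not a closing of `stub_residual`; the residual label of record is UNCHANGED («`ResidualLawV23` = `PlanarCellBound` as a
law», `Negative/RaySplitResidual.residualV23_iff_planarCellBound`, p662518).  Nothing here closes 5906 (`TwoProducts` / `ResidualLawV23` /
`PlanarCellBound` remain OPEN); VP ≠ VNP is NOT proved.  No instances, no notation, no named facts.
-/

noncomputable section

-- Sub = Summit single-conjunct layout: the duplicated namespace component is mandated by the tree.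
set_option linter.dupNamespace false

open scoped BigOperators
open MvPolynomial
open Summit.ValiantsHypothesis.ValiantsHypothesis.Theorems.NewtonUnitEquations.TwoProducts.FormalLogLinearisation
open Summit.ValiantsHypothesis.ValiantsHypothesis.Theorems.NewtonUnitEquations.TwoProducts.PlanarCell

namespace Summit.ValiantsHypothesis.ValiantsHypothesis.Theorems.NewtonUnitEquations.TwoProducts.Submerged

variable {m : ℕ}

/-- A SUBMERGED cell family: a cell family (verbatim the body of `IsCellFamily`) each of whose points lies strictly
BELOW EVERY tail letter at its witnessing weight. -/
def IsSubmergedCellFamily (u v : Fin m → MvPolynomial (Fin 2) ℂ) (R : Expo → Expo → Prop) (S : Finset Expo) :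
    Prop :=
  ∀ l ∈ S, ∃ ξ : Fin 2 → ℝ, ValidWeight u v ξ ∧ IsStrictTop ξ (logSupport u v) l ∧
    (∀ e ∈ tailSupport u v, ∀ e' ∈ tailSupport u v, (R e e' ↔ wt ξ e ≤ wt ξ e')) ∧
    ∀ e ∈ tailSupport u v, wt ξ l < wt ξ e

/-- Truncation by one letter: delete the monomial `X^e` from every tail (both sides, all positions). -/
noncomputable def dropLetter (u : Fin m → MvPolynomial (Fin 2) ℂ) (e : Expo) :
    Fin m → MvPolynomial (Fin 2) ℂ :=
  fun j => u j - monomial e (coeff e (u j))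

/-- **L1 (band step — exact scale separation at the floor).**  If `e` is a lowest tail letter for the valid weight
`ξ`, deleting `X^e` everywhere does not change any coefficient of `∏(1+u_j) − ∏(1+v_j)` strictly above `e`
(the difference is `Σ_{J ≠ ∅} (∏_{j∈J} c_j) X^{|J| e} ∏_{j∉J}(1+u°_j) − (same for v)`, all of whose monomials weigh
`≤ wt ξ e`), hence strict tops strictly above `e` are the same for the two families. -/
def BandStep : Prop :=
  ∀ (m : ℕ) (u v : Fin m → MvPolynomial (Fin 2) ℂ) (ξ : Fin 2 → ℝ), ValidWeight u v ξ →
    ∀ e ∈ tailSupport u v, (∀ e' ∈ tailSupport u v, wt ξ e ≤ wt ξ e') →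
      (∀ x : Expo, wt ξ e < wt ξ x →
          coeff x (tailDiff u v) = coeff x (tailDiff (dropLetter u e) (dropLetter v e))) ∧
      (∀ l : Expo, wt ξ e < wt ξ l →
          (IsStrictTop ξ (↑(tailDiff u v).support) l ↔
            IsStrictTop ξ (↑(tailDiff (dropLetter u e) (dropLetter v e)).support) l))

/-- The per-cell law with exponents `(a, b)` (the conclusion shape of `ResidualLawV20`, all families). -/
def CellLaw (a b : ℕ) : Prop :=
  ∀ (m t : ℕ), 2 ≤ t → ∀ (u v : Fin m → MvPolynomial (Fin 2) ℂ),
    (∀ j, coeff 0 (u j) = 0 ∧ (u j).support.card ≤ t) → (∀ j, coeff 0 (v j) = 0 ∧ (v j).support.card ≤ t) →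
    ∀ (R : Expo → Expo → Prop) (S : Finset Expo), IsCellFamily u v R S → S.card ≤ 2 ^ (a * m) * (t + 2) ^ b

/-- The per-cell law demanded of SUBMERGED cell families only. -/
def SubmergedCellLaw (a b : ℕ) : Prop :=
  ∀ (m t : ℕ), 2 ≤ t → ∀ (u v : Fin m → MvPolynomial (Fin 2) ℂ),
    (∀ j, coeff 0 (u j) = 0 ∧ (u j).support.card ≤ t) → (∀ j, coeff 0 (v j) = 0 ∧ (v j).support.card ≤ t) →
    ∀ (R : Expo → Expo → Prop) (S : Finset Expo), IsSubmergedCellFamily u v R S →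
      S.card ≤ 2 ^ (a * m) * (t + 2) ^ b

/-- **L2 (band filtration ⇒ submerged normal form).**  Every visible point of a cell other than the (at most one,
`PlanarCell.eq_of_visible_mem_tailSupport`) visible letter lies in a band `(e_{k+1}, e_k)` of the cell's letter order
and is then, by `BandStep` iterated from the floor, a SUBMERGED visible point of the truncation to the top `k`
letters (same `m`, sparsity `≤ t`); `≤ #tailSupport + 1 ≤ 2mt + 1 ≤ 2^m (t+2)` bands. -/
def SubmergedReduction : Prop := ∀ a b : ℕ, SubmergedCellLaw a b → CellLaw (a + 1) (b + 1)

/-- A letter `e` is COMPOSITE for the letter family `A` if it is the point of a letter tuple with `≥ 2` non-zero slots. -/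
def IsComposite (A : Fin m → Finset Expo) (e : Expo) : Prop :=
  ∃ a ∈ tuples A, (∑ j, a j) = e ∧ 2 ≤ (Finset.univ.filter fun j => a j ≠ 0).card

/-- **L3 (first-order balance).**  In a non-empty submerged cell every tail letter is a cancelled point of
`∏(1+u_j) − ∏(1+v_j)`; for a NON-composite letter the fibre over it consists of the single-letter tuples only, so
its column sums balance: `Σ_j [X^e] u_j = Σ_j [X^e] v_j`.  (Generic coefficients violate this: the located first
inhabitants of the residual — shared generic alphabets with planted relations — have NO submerged cell.) -/
def FirstOrderBalance : Prop :=
  ∀ (m : ℕ) (u v : Fin m → MvPolynomial (Fin 2) ℂ), (∀ j, coeff 0 (u j) = 0) → (∀ j, coeff 0 (v j) = 0) →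
    ∀ (R : Expo → Expo → Prop) (S : Finset Expo), IsSubmergedCellFamily u v R S → S.Nonempty →
      ∀ e ∈ tailSupport u v, ¬ IsComposite (fun j => (u j).support ∪ (v j).support) e →
        ∑ j, coeff e (u j) = ∑ j, coeff e (v j)

/-! ## APPENDED (val-lit-p3 g17, second revision): L4 `HighLetterPairing` and L5 `SubmergedDepthBound` — lines 84–109 of the same
Sketch.lean (sha16 f2f87b116489a0e6), VERBATIM; proofs in `…SubmergedHighLetterPairing` (`highLetterPairing_holds`,
`submergedDepthBound_holds`).  Same honest label: infrastructure of K4; nothing closes 5906; VP ≠ VNP NOT proved. -/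

/-- **L4 (Newton–Vieta pairing of the HIGH letters — the lever).**  One shared alphabet `E`; a set `H ⊆ E` of letters
with PURE fibres (tuples over `E` with the same point as an `H`-tuple are position-permutations of it) all of whose
non-zero tuple points lie above a strict top `l`: then every such point is cancelled, the cancelled fibre sums are the
polarised elementary symmetric functions `e_k`, `k ≤ m`, of the rows `(u_j|_H)_j` resp. `(v_j|_H)_j`, and equal
`e_1 … e_m` of `Σ_e λ_e u_j[e]` for all `λ` force the two row multisets to coincide: `v_{σ j}|_H = u_j|_H`.
Permutation type on the high band is DERIVED from cancellation, not assumed. -/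
def HighLetterPairing : Prop :=
  ∀ (m : ℕ) (u v : Fin m → MvPolynomial (Fin 2) ℂ) (E H : Finset Expo),
    (∀ j, coeff 0 (u j) = 0) → (∀ j, coeff 0 (v j) = 0) →
    (∀ j, (u j).support ⊆ E) → (∀ j, (v j).support ⊆ E) → H ⊆ E →
    (∀ a ∈ tuples (fun _ : Fin m => E), ∀ b ∈ tuples (fun _ : Fin m => E), (∀ j, a j = 0 ∨ a j ∈ H) →
        (∑ j, a j) = ∑ j, b j → ∃ σ : Equiv.Perm (Fin m), ∀ j, b j = a (σ j)) →
    ∀ (ξ : Fin 2 → ℝ) (l : Expo), ValidWeight u v ξ → IsStrictTop ξ (↑(tailDiff u v).support) l →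
      (∀ a ∈ tuples (fun _ : Fin m => H), a ≠ 0 → wt ξ l < wt ξ (∑ j, a j)) →
      ∃ σ : Equiv.Perm (Fin m), ∀ j, ∀ e ∈ H, coeff e (v (σ j)) = coeff e (u j)

/-- **L5 (depth corollary).**  With pure fibres on the WHOLE alphabet (`H = E`), a submerged visible point lies within a
factor `m` of the floor: NOT every `m`-fold letter point is above it (else `v = u ∘ σ` and `∏(1+u) = ∏(1+v)`). -/
def SubmergedDepthBound : Prop :=
  ∀ (m : ℕ) (u v : Fin m → MvPolynomial (Fin 2) ℂ) (E : Finset Expo),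
    (∀ j, coeff 0 (u j) = 0) → (∀ j, coeff 0 (v j) = 0) →
    (∀ j, (u j).support ⊆ E) → (∀ j, (v j).support ⊆ E) →
    (∀ a ∈ tuples (fun _ : Fin m => E), ∀ b ∈ tuples (fun _ : Fin m => E),
        (∑ j, a j) = ∑ j, b j → ∃ σ : Equiv.Perm (Fin m), ∀ j, b j = a (σ j)) →
    ∀ (ξ : Fin 2 → ℝ) (l : Expo), ValidWeight u v ξ → IsStrictTop ξ (↑(tailDiff u v).support) l →
      ∃ a ∈ tuples (fun _ : Fin m => E), a ≠ 0 ∧ wt ξ (∑ j, a j) ≤ wt ξ l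

end Summit.ValiantsHypothesis.ValiantsHypothesis.Theorems.NewtonUnitEquations.TwoProducts.Submerged

end
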